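import Literature.Geometry.Kaehler.ComplexTorusSubvarieties
import Literature.LinearAlgebra.FreeModule.AlternatingElementaryDivisors
import HarnessLib

/-!
# The type of a polarisation: a Frobenius basis of the lattice of a polarised complex torus

Companion of `Literature/Geometry/Kaehler/ComplexTorusSubvarieties.lean` (`ComplexTorus.IsRiemannForm Φ ω`,
`ComplexTorus.IsAbelianVariety Φ`: a Riemann form `ω = Im H` for the torus `X = E/Φ(ℤ^ι)`, integral on
the lattice, `ω(iu, u) > 0`) and of `Literature/LinearAlgebra/FreeModule/AlternatingElementaryDivisors.lean`
(Frobenius' normal form of a non-degenerate integral alternating form).  It proves the first step of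
the reduction of a polarised complex torus to a period matrix `(Z, D)` — Lange–Birkenhake, *Complex
Abelian Varieties*, §3.1 ("elementary divisors": for a non-degenerate alternating form `E` on the
lattice `Λ` there is a basis `λ₁, …, λ_g, μ₁, …, μ_g` of `Λ` in which `E = ( 0 D ; -D 0 )`,
`D = diag(d₁, …, d_g)`, `dᵢ > 0`, `dᵢ ∣ dᵢ₊₁`; the vector `(d₁, …, d_g)` is the TYPE of the
polarisation) and §8.1 (period matrices of polarised abelian varieties of type `D`):

* `exists_bilinForm_int_of_integral` — a real `2`-form integral on `Φ(ℤ^ι)` restricts to an integral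
  bilinear form `B : ℤ^ι × ℤ^ι → ℤ`, `B(m, n) = ω(Φm, Φn)`;
* `IsRiemannForm.exists_frobeniusBasis` — **for a Riemann form `ω` of `E/Φ(ℤ^ι)` the lattice `ℤ^ι`
  has a `ℤ`-basis `λ₁, …, λ_g, μ₁, …, μ_g` with `ω(Φλᵢ, Φλⱼ) = ω(Φμᵢ, Φμⱼ) = 0`,
  `ω(Φλᵢ, Φμⱼ) = dᵢ δᵢⱼ`, `0 < d₁ ∣ d₂ ∣ ⋯ ∣ d_g`** (the restriction of `ω` to the lattice is
  alternating and, by positivity of `H`, non-degenerate, so Frobenius' theorem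
  `Literature.LinearAlgebra.FreeModule.exists_frobeniusBasis` applies);
* `IsRiemannForm.card_index_eq` — in particular `|ι| = 2g`;
* `IsAbelianVariety.exists_frobeniusBasis` — the same for `IsAbelianVariety Φ`.

Everything is proved; no definition, no named fact.  Not here: the change of the period isomorphism
`Φ ↦ Φ ∘ b` to the Frobenius basis (an isomorphic torus, `ComplexTorusMaps.lean`) and the
normalisation of the period matrix to `(Z, D)` with `Z` in the Siegel upper half space
(Lange–Birkenhake §8.1), which are the next steps towards Lefschetz's theorem for a general
polarisation (the principal Siegel case is `SiegelTorusThetaEmbedding.lean`).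

## References

* [LangeBirkenhake1992] H. Lange, Ch. Birkenhake, *Complex Abelian Varieties*, §3.1 (type of a
  polarisation, elementary divisors of `E|_Λ`), Lemma 2.1.7, §4.1, §8.1.
* [AdkinsWeintraub1992] W. A. Adkins, S. H. Weintraub, *Algebra*, GTM 136, Ch. 6 Thm. (2.35).
-/

noncomputable section

namespace Literature.Geometry.Kaehler

namespace ComplexTorus

open Literature.LinearAlgebra.FreeModule

variable {ι : Type*} {E : Type*} [NormedAddCommGroup E] [NormedSpace ℂ E]

/-! ### Bilinear calculus for a real `2`-form (private) -/

section TwoForm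

variable (c : E [⋀^Fin 2]→L[ℝ] ℝ)

/-- Antisymmetry `c(x, y) = -c(y, x)`. [folklore] -/
private theorem alt_swap (x y : E) : c ![x, y] = -c ![y, x] := by
  have h := c.toAlternatingMap.map_swap ![y, x] (show (0 : Fin 2) ≠ 1 by decide)
  have e : (![y, x] ∘ Equiv.swap (0 : Fin 2) 1) = ![x, y] := by
    funext i; fin_cases i <;> rfl
  rw [e] at h
  exact h

/-- Additivity in the first slot. [folklore] -/
private theorem alt_add₀ (x x' y : E) : c ![x + x', y] = c ![x, y] + c ![x', y] :=
  c.vecCons_add ![y] x x'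

/-- Homogeneity in the first slot. [folklore] -/
private theorem alt_smul₀ (r : ℝ) (x y : E) : c ![r • x, y] = r • c ![x, y] :=
  c.vecCons_smul ![y] r x

/-- Additivity in the second slot. [folklore] -/
private theorem alt_add₁ (x y y' : E) : c ![x, y + y'] = c ![x, y] + c ![x, y'] := by
  rw [alt_swap c x (y + y'), alt_add₀, neg_add, ← alt_swap, ← alt_swap]

/-- Homogeneity in the second slot. [folklore] -/
private theorem alt_smul₁ (r : ℝ) (x y : E) : c ![x, r • y] = r • c ![x, y] := by
  rw [alt_swap c x (r • y), alt_smul₀, ← smul_neg, ← alt_swap]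

end TwoForm

/-- `intVec` is additive. [folklore] -/
private theorem intVec_add (m n : ι → ℤ) : intVec (m + n) = intVec m + intVec n := by
  funext i; simp [intVec]

/-- `intVec` commutes with integer scalars. [folklore] -/
private theorem intVec_zsmul (a : ℤ) (m : ι → ℤ) : intVec (a • m) = (a : ℝ) • intVec m := by
  funext i; simp [intVec]

/-- `intVec` of a standard basis vector is the standard basis vector. [folklore] -/
private theorem intVec_single [DecidableEq ι] (i : ι) :
    intVec (Pi.single i (1 : ℤ)) = Pi.single i (1 : ℝ) := by
  funext j
  by_cases h : j = i
  · subst h; simp [intVec]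
  · simp [intVec, h]

/-- `intVec` is injective. [folklore] -/
private theorem intVec_injective : Function.Injective (intVec : (ι → ℤ) → ι → ℝ) := fun m n h => by
  funext i
  have := congrFun h i
  simpa [intVec] using this

/-! ### The lattice form of an integral `2`-form -/

/-- **The lattice form.** A real `2`-form `ω` on `E` which is integral on the lattice `Φ(ℤ^ι)` of the
torus `E/Φ(ℤ^ι)` ("`Im H(Λ, Λ) ⊆ ℤ`", Lange–Birkenhake Prop. 2.1.6) restricts to an integral bilinear
form `B` on `ℤ^ι` with `B(m, n) = ω(Φm, Φn)` in `ℝ`. [cite: LangeBirkenhake1992, §2.1 Prop. 2.1.6 and §3.1] -/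
theorem exists_bilinForm_int_of_integral {Φ : (ι → ℝ) ≃L[ℝ] E} {ω : E [⋀^Fin 2]→L[ℝ] ℝ}
    (hint : ∀ m n : ι → ℤ, ∃ k : ℤ, ω ![Φ (intVec m), Φ (intVec n)] = k) :
    ∃ B : LinearMap.BilinForm ℤ (ι → ℤ), ∀ m n, (B m n : ℝ) = ω ![Φ (intVec m), Φ (intVec n)] := by
  choose k hk using hint
  refine ⟨LinearMap.mk₂ ℤ k (fun m₁ m₂ n => ?_) (fun a m n => ?_) (fun m n₁ n₂ => ?_)
    (fun a m n => ?_), fun m n => (hk m n).symm⟩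
  · have : ((k (m₁ + m₂) n : ℤ) : ℝ) = (k m₁ n : ℝ) + (k m₂ n : ℝ) := by
      rw [← hk, ← hk, ← hk, intVec_add, map_add, alt_add₀]
    exact_mod_cast this
  · have : ((k (a • m) n : ℤ) : ℝ) = (a : ℝ) * (k m n : ℝ) := by
      rw [← hk, ← hk, intVec_zsmul, map_smul, alt_smul₀, smul_eq_mul]
    rw [smul_eq_mul]
    exact_mod_cast this
  · have : ((k m (n₁ + n₂) : ℤ) : ℝ) = (k m n₁ : ℝ) + (k m n₂ : ℝ) := by
      rw [← hk, ← hk, ← hk, intVec_add, map_add, alt_add₁]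
    exact_mod_cast this
  · have : ((k m (a • n) : ℤ) : ℝ) = (a : ℝ) * (k m n : ℝ) := by
      rw [← hk, ← hk, intVec_zsmul, map_smul, alt_smul₁, smul_eq_mul]
    rw [smul_eq_mul]
    exact_mod_cast this

/-! ### Frobenius bases of the lattice of a polarised torus -/

variable [Fintype ι]

/-- A Riemann form pairs non-degenerately with the lattice: if `ω(Φm, Φn) = 0` for all lattice vectors
`n` then `m = 0` (the lattice spans `ℝ^ι`, and `ω(iu, u) > 0` for `u ≠ 0`). [cite: LangeBirkenhake1992, Lemma 2.1.7] -/
theorem IsRiemannForm.eq_zero_of_forall_lattice {Φ : (ι → ℝ) ≃L[ℝ] E} {ω : E [⋀^Fin 2]→L[ℝ] ℝ}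
    (h : IsRiemannForm Φ ω) {m : ι → ℤ} (hm : ∀ n : ι → ℤ, ω ![Φ (intVec m), Φ (intVec n)] = 0) :
    m = 0 := by
  classical
  set u : E := Φ (intVec m) with hu
  -- `v ↦ ω(u, Φ v)` is a linear form on `ℝ^ι` vanishing on the standard basis, hence zero
  let L : (ι → ℝ) →ₗ[ℝ] ℝ :=
    { toFun := fun v => ω ![u, Φ v]
      map_add' := fun v w => by simp only [map_add, alt_add₁]
      map_smul' := fun r v => by simp only [map_smul, alt_smul₁, smul_eq_mul, RingHom.id_apply] }
  have hL : L = 0 := by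
    refine (Pi.basisFun ℝ ι).ext fun i => ?_
    rw [Pi.basisFun_apply, LinearMap.zero_apply]
    change ω ![u, Φ (Pi.single i 1)] = 0
    rw [← intVec_single, hu]
    exact hm _
  have hzero : ∀ v : E, ω ![u, v] = 0 := fun v => by
    have := LinearMap.congr_fun hL (Φ.symm v)
    simpa [L] using this
  have hu0 : u = 0 := by
    by_contra hne
    have hpos := h.2.2 u hne
    rw [alt_swap, hzero, neg_zero] at hpos
    exact lt_irrefl _ hpos
  apply intVec_injective
  rw [show intVec (0 : ι → ℤ) = (0 : ι → ℝ) from funext fun i => by simp [intVec]]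
  exact Φ.injective (by rw [map_zero]; exact hu ▸ hu0)

/-- **Frobenius basis of the lattice of a polarised complex torus (the type of a polarisation).**  If
`ω` is a Riemann form for the torus `E/Φ(ℤ^ι)`, the lattice `ℤ^ι` has a `ℤ`-basis
`b : Fin g ⊕ Fin g → ℤ^ι` (`inl i ↦ λᵢ`, `inr i ↦ μᵢ`) and natural numbers `0 < d₁ ∣ d₂ ∣ ⋯ ∣ d_g` with
`ω(Φλᵢ, Φλⱼ) = ω(Φμᵢ, Φμⱼ) = 0` and `ω(Φλᵢ, Φμⱼ) = dᵢ δᵢⱼ`: Lange–Birkenhake §3.1, "the elementary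
divisors of `E = Im H` on `Λ` … the matrix of `E` is `( 0 D ; -D 0 )`, `D = diag(d₁, …, d_g)`, the type
of the polarisation", obtained from Frobenius' theorem (`exists_frobeniusBasis`) applied to the lattice
form, which is alternating and (positivity) non-degenerate. [cite: LangeBirkenhake1992, §3.1 (type of a polarisation)] -/
theorem IsRiemannForm.exists_frobeniusBasis {Φ : (ι → ℝ) ≃L[ℝ] E} {ω : E [⋀^Fin 2]→L[ℝ] ℝ}
    (h : IsRiemannForm Φ ω) :
    ∃ (g : ℕ) (b : Module.Basis (Fin g ⊕ Fin g) ℤ (ι → ℤ)) (d : Fin g → ℕ),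
      (∀ i, 0 < d i) ∧ (∀ i j, i ≤ j → d i ∣ d j) ∧
      (∀ i j, ω ![Φ (intVec (b (Sum.inl i))), Φ (intVec (b (Sum.inl j)))] = 0) ∧
      (∀ i j, ω ![Φ (intVec (b (Sum.inr i))), Φ (intVec (b (Sum.inr j)))] = 0) ∧
      (∀ i j, ω ![Φ (intVec (b (Sum.inl i))), Φ (intVec (b (Sum.inr j)))] =
        if i = j then (d i : ℝ) else 0) := by
  obtain ⟨B, hB⟩ := exists_bilinForm_int_of_integral h.2.1
  have hA : B.IsAlt := fun m => by
    have : ((B m m : ℤ) : ℝ) = 0 := by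
      rw [hB, alt_swap]
      linarith [alt_swap ω (Φ (intVec m)) (Φ (intVec m))]
    exact_mod_cast this
  have hN : B.Nondegenerate := by
    refine hA.isRefl.nondegenerate_iff_separatingLeft.2 fun m hm => ?_
    exact h.eq_zero_of_forall_lattice fun n => by rw [← hB, hm n, Int.cast_zero]
  obtain ⟨g, b, d, hdpos, hchain, huu, hvv, huv⟩ :=
    Literature.LinearAlgebra.FreeModule.exists_frobeniusBasis B hA hN
  refine ⟨g, b, d, hdpos, hchain, fun i j => ?_, fun i j => ?_, fun i j => ?_⟩
  · rw [← hB, huu, Int.cast_zero]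
  · rw [← hB, hvv, Int.cast_zero]
  · rw [← hB, huv]
    split_ifs <;> simp

/-- For a polarised complex torus `E/Φ(ℤ^ι)` the lattice has even rank: `|ι| = 2g` with `g` the number
of elementary divisors (the real dimension of `E` is twice its complex dimension).
[cite: LangeBirkenhake1992, §3.1 (type of a polarisation)] -/
theorem IsRiemannForm.card_index_eq {Φ : (ι → ℝ) ≃L[ℝ] E} {ω : E [⋀^Fin 2]→L[ℝ] ℝ}
    (h : IsRiemannForm Φ ω) : ∃ g : ℕ, Fintype.card ι = 2 * g := by
  obtain ⟨g, b, -, -⟩ := h.exists_frobeniusBasis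
  refine ⟨g, ?_⟩
  have h1 := Module.finrank_eq_card_basis b
  rw [Module.finrank_fintype_fun_eq_card, Fintype.card_sum, Fintype.card_fin] at h1
  omega

/-- **An abelian variety (polarised complex torus) has a lattice basis of Frobenius type**: for
`IsAbelianVariety Φ` there are a Riemann form `ω`, a `ℤ`-basis `λ₁, …, λ_g, μ₁, …, μ_g` of `ℤ^ι` and a
type `0 < d₁ ∣ ⋯ ∣ d_g` with `ω(Φλᵢ, Φλⱼ) = ω(Φμᵢ, Φμⱼ) = 0`, `ω(Φλᵢ, Φμⱼ) = dᵢ δᵢⱼ`.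
[cite: LangeBirkenhake1992, §3.1 (type of a polarisation) and §4.1] -/
theorem IsAbelianVariety.exists_frobeniusBasis {Φ : (ι → ℝ) ≃L[ℝ] E} (h : IsAbelianVariety Φ) :
    ∃ (ω : E [⋀^Fin 2]→L[ℝ] ℝ) (g : ℕ) (b : Module.Basis (Fin g ⊕ Fin g) ℤ (ι → ℤ)) (d : Fin g → ℕ),
      IsRiemannForm Φ ω ∧ (∀ i, 0 < d i) ∧ (∀ i j, i ≤ j → d i ∣ d j) ∧
      (∀ i j, ω ![Φ (intVec (b (Sum.inl i))), Φ (intVec (b (Sum.inl j)))] = 0) ∧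
      (∀ i j, ω ![Φ (intVec (b (Sum.inr i))), Φ (intVec (b (Sum.inr j)))] = 0) ∧
      (∀ i j, ω ![Φ (intVec (b (Sum.inl i))), Φ (intVec (b (Sum.inr j)))] =
        if i = j then (d i : ℝ) else 0) := by
  obtain ⟨ω, hω⟩ := h
  obtain ⟨g, b, d, h1, h2, h3, h4, h5⟩ := hω.exists_frobeniusBasis
  exact ⟨ω, g, b, d, hω, h1, h2, h3, h4, h5⟩

/-- **Symplectic `ℤ`-basis of type `D`, in the shape consumed by the Siegel normal form**
(`ComplexTorus.exists_siegelForm_typeD`, `exists_siegelTorus_typeD` of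
`ComplexTorusSiegelNormalForm.lean`): both halves isotropic and `η(Φ b₂ᵢ, Φ b₁ⱼ) = dᵢ δᵢⱼ` with
`0 < d₁ ∣ d₂ ∣ ⋯ ∣ d_g` — the Frobenius basis of `IsRiemannForm.exists_frobeniusBasis` with its two halves
exchanged (`b.reindex (Equiv.sumComm _ _)`), matching the tree's positivity convention `η(iu, u) > 0`.
[cite: LangeBirkenhake1992, §3.1 (type of a polarisation) and §8.1 Prop. 8.1.1] -/
theorem IsRiemannForm.exists_symplecticBasis_typeD {Φ : (ι → ℝ) ≃L[ℝ] E} {η : E [⋀^Fin 2]→L[ℝ] ℝ}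
    (h : IsRiemannForm Φ η) :
    ∃ (g : ℕ) (b : Module.Basis (Fin g ⊕ Fin g) ℤ (ι → ℤ)) (d : Fin g → ℕ),
      (∀ i, 0 < d i) ∧ (∀ i j, i ≤ j → d i ∣ d j) ∧
      (∀ i j, η ![Φ (intVec (b (Sum.inl i))), Φ (intVec (b (Sum.inl j)))] = 0) ∧
      (∀ i j, η ![Φ (intVec (b (Sum.inr i))), Φ (intVec (b (Sum.inr j)))] = 0) ∧
      (∀ i j, η ![Φ (intVec (b (Sum.inr i))), Φ (intVec (b (Sum.inl j)))] =
        if i = j then (d i : ℝ) else 0) := by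
  obtain ⟨g, b, d, h1, h2, h3, h4, h5⟩ := h.exists_frobeniusBasis
  refine ⟨g, b.reindex (Equiv.sumComm (Fin g) (Fin g)), d, h1, h2, fun i j => ?_, fun i j => ?_,
    fun i j => ?_⟩
  · simpa only [Module.Basis.reindex_apply, Equiv.sumComm_symm, Equiv.sumComm_apply,
      Sum.swap_inl] using h4 i j
  · simpa only [Module.Basis.reindex_apply, Equiv.sumComm_symm, Equiv.sumComm_apply,
      Sum.swap_inr] using h3 i j
  · simpa only [Module.Basis.reindex_apply, Equiv.sumComm_symm, Equiv.sumComm_apply,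
      Sum.swap_inl, Sum.swap_inr] using h5 i j

end ComplexTorus

end Literature.Geometry.Kaehler

end
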